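import Summits.KontsevichZagierPeriods.KontsevichZagierPeriods.Theorems.LinRedNormalFormArrangementNormalFormStubRebaseSimplePosOnePosParTriple

/-!
# Stub `stub_rebaseSimplePosOnePos` (crux `ArrangementNormalForm`, line `janus-bands`) —
part `ParTripleFlat`: the one-fibre rebase reduced to TRIPLE POINTS (any base dimension)

Assembly of parts `Flats`, `ParTripleTools`, `ParTriple`. The residual hypothesis `Hpar` of the
one-fibre rebase (one lettered fibre `t`, letter `0`, affine bounds `0 < u < v` PARALLEL in `y`
with common slope `s ≠ 0`, base factor `p(x')/∏ Lⱼ(x')^{eⱼ} · 1/(y − ℓ₂(x'))`, bounded base cell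
in `ℝ^{B+1}`) holds as soon as it holds for the restrictions to the PRODUCT cells
`{x'-rows M₀} × (ylo(x'), yhi(x'))` whose closed cell `closure {rows > 0}` contains a TRIPLE
POINT: a point `z` with `ylo(z) = yhi(z)` (the `y`-range pinches), `u(z) = v(z)` (the width
`w = v − u` vanishes) AND `u₀(z) + s ℓ₂(z) = 0` (the lower bound vanishes on the pole hyperplane
`y = ℓ₂(x')`): `RebasePos.good_par_of_triple`, registered as `rebaseSimplePos_par_of_triple`.
Proof: `rebaseSimplePos_par_cells`; on a product cell without triple point,
`RebasePos.good_parCell_of_noTriple'` first disposes of a degenerate `x'`-factor (zero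
integrand), gets the pole outside the `y`-range from absolute convergence (`pole_outside`), makes
the `y`-range non-degenerate on the `x'`-cell by one cut along `yhi − ylo = 0` (rule 1a; the
other piece is empty), and calls `RebasePos.good_parCell_of_noTriple` (part `ParTriple`).
Consequently the stub `stub_rebaseSimplePosOnePos` holds under the residual hypotheses
`HparTriple` (parallel bands over a product cell with a triple point), `Hdthick`, `Hdfar`
(double corners, verbatim from part `Flats`): `rebaseSimplePosOnePos_of_triple'`.

For `B = 1` there is no flat at all (part `ParOne`); for `B = 2` a triple point is a point `x'₀`
of the closed `x'`-cell with `h(x'₀) = w(x'₀) = κ'(x'₀) = 0` — three affine conditions on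
`x' ∈ ℝ²`, so triple points occur only when the three lines `{h = 0}`, `{w = 0}`, `{κ' = 0}` are
concurrent or degenerate, e.g.
`[{0 < x₂ < x₁ < 1, 0 < y < x₁, y + x₂ < t < y + 2 x₂}, 1/(x₁ (y + x₂) t)]` (`h = x₁`, `w = x₂`,
`ℓ₂ = −x₂`, `κ' = u₀ + s ℓ₂ = x₂ − x₂ = 0` identically; triple point `x'₀ = 0`).

References: M. Kontsevich, D. Zagier, *Periods* (2001), §1.2, rules (1a), (1b), (2).
-/

noncomputable section

open Set MeasureTheory MvPolynomial
open Literature.NumberTheory.Transcendental Literature.ModelTheory.ExponentialFields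

namespace Summit.KontsevichZagierPeriods.ArrangementNormalForm.JanusBands

namespace RebasePos

open SeparatePos

section TripleFlat

variable {B m m' m₀ : ℕ} (L : Fin m → (Fin B → ℚ) × ℚ) (e : Fin m → ℕ) (ℓ₁ ℓ₂ : (Fin B → ℚ) × ℚ)

/-- **A product cell without triple point is closed** — the hypotheses `hne` (non-degenerate
`y`-range) and `hpole` (pole outside the range) of `good_parCell_of_noTriple` removed: a
degenerate `x'`-factor gives a zero integrand, `pole_outside` gives `hpole`, and one cut along
`yhi − ylo = 0` (rule 1a) gives `hne` (the piece `yhi < ylo` is empty). -/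
theorem good_parCell_of_noTriple' (s : KZ.IntegralRep (B + 1 + 1)) (M : Fin m' → (Fin (B + 1) → ℚ) × ℚ)
    (M₀ : Fin m₀ → (Fin B → ℚ) × ℚ) (ylo yhi : (Fin B → ℚ) × ℚ) (p : MvPolynomial (Fin B) ℚ)
    (u v : (Fin (B + 1) → ℚ) × ℚ) (hbd : Bornology.IsBounded s.domain)
    (hdom : s.domain = gDom B 1 m' M (fun _ => Sum.inr u) (fun _ => Sum.inr v))
    (hint : EqOn s.integrand (glit B 1 p L e ℓ₁ ℓ₂ 0 1 (fun _ => some 0)) s.domain)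
    (hu : u.1 (Fin.last B) ≠ 0) (hpar : u.1 (Fin.last B) = v.1 (Fin.last B))
    (hcell : ∀ z : Fin (B + 1 + 1) → ℝ, (∀ j, 0 < affF B 1 (M j) z) → 0 < affF B 1 u z ∧ affF B 1 u z < affF B 1 v z)
    (hsec : ∀ z : Fin (B + 1 + 1) → ℝ, (∀ j, 0 < affF B 1 (M j) z) ↔ ((∀ j, 0 < affB B 1 (M₀ j) z) ∧
      affB B 1 ylo z < z (Fin.castAdd 1 (Fin.last B)) ∧ z (Fin.castAdd 1 (Fin.last B)) < affB B 1 yhi z))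
    (hnt : ∀ z ∈ closure {z : Fin (B + 1 + 1) → ℝ | ∀ j, 0 < affF B 1 (M j) z},
      affB B 1 ylo z = affB B 1 yhi z → affF B 1 u z = affF B 1 v z →
      affB B 1 (restr B u) z + (u.1 (Fin.last B) : ℝ) * affB B 1 ℓ₂ z = 0 → False) :
    ∃ c ∈ AddSubgroup.closure (GGset B 2 1), KZ.of s - c ∈ KZ.relations := by
  by_cases hdeg : p = 0 ∨ ∃ j, e j ≠ 0 ∧ L j = 0
  · -- the integrand vanishes on the domain
    refine ⟨0, zero_mem _, ?_⟩
    rw [sub_zero]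
    refine KZ.of_mem_relations_of_eqOn_zero s fun z hz => ?_
    rw [hint hz, Pi.zero_apply, glit_one]
    rcases hdeg with hp | ⟨j, hej, hLj⟩
    · rw [hp, map_zero, zero_div, zero_mul, zero_mul]
    · have h0 : ∏ j, (affB B 1 (L j) z) ^ e j = 0 := by
        refine Finset.prod_eq_zero (Finset.mem_univ j) ?_
        rw [hLj]
        simp [affB, hej]
      rw [h0, div_zero, zero_mul, zero_mul]
  push Not at hdeg
  obtain ⟨hp, hL⟩ := hdeg
  -- the height `h = yhi − ylo` as an extra `x'`-row
  set hF : (Fin B → ℚ) × ℚ := yhi - ylo with hhF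
  have hhz : ∀ z : Fin (B + 1 + 1) → ℝ, affB B 1 hF z = affB B 1 yhi z - affB B 1 ylo z :=
    fun z => by rw [hhF, affB_sub]
  by_cases hF0 : hF = 0
  · refine good_of_null s ?_
    rw [hdom]
    refine measure_mono_null (fun z hz => ?_) measure_empty
    obtain ⟨-, hlo, hhi⟩ := (hsec z).1 ((mem_gDom_one M u v z).1 hz).1
    have h := hhz z
    rw [hF0, affB_zeroYT] at h
    exact absurd h (by linarith)
  obtain ⟨s₁, s₂, hsub₁, hsub₂, hi₁, hi₂, hd₁, hd₂, hsec₁, hsec₂, hrel⟩ :=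
    cutCell s M M₀ ylo yhi u v hdom hsec hF hF0
  refine good_of_split hrel ?_ ?_
  · -- `yhi > ylo` on the `x'`-cell; the pole is outside the `y`-range by `pole_outside`
    have hint₁ : EqOn s₁.integrand (glit B 1 p L e ℓ₁ ℓ₂ 0 1 (fun _ => some 0)) s₁.domain := by
      rw [hi₁]; exact hint.mono hsub₁
    have hcell₁ : ∀ z : Fin (B + 1 + 1) → ℝ, (∀ j, 0 < affF B 1 ((Fin.snoc M (liftX hF) : Fin (m' + 1) → _) j) z) →
        0 < affF B 1 u z ∧ affF B 1 u z < affF B 1 v z := fun z hz => hcell z (rows_snoc hz).1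
    refine good_parCell_of_noTriple L e ℓ₁ ℓ₂ s₁ _ (Fin.snoc M₀ hF) ylo yhi p u v (hbd.subset hsub₁) hd₁ hint₁
      hu hpar hcell₁ hsec₁ (fun z hz => ?_)
      (pole_outside L e ℓ₁ ℓ₂ s₁ _ (Fin.snoc M₀ hF) ylo yhi p u v hd₁ hint₁ hpar hcell₁ hsec₁ hp hL)
      (fun z hz h1 h2 h3 => hnt z (closure_mono (fun w hw => (rows_snoc hw).1) hz) h1 h2 h3)
    have h := (rowsB_snoc_iff.1 hz).2
    rw [hhz] at h
    linarith
  · -- `yhi < ylo`: empty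
    refine good_of_null s₂ ?_
    rw [hd₂]
    refine measure_mono_null (fun z hz => ?_) measure_empty
    obtain ⟨h0, hlo, hhi⟩ := (hsec₂ z).1 ((mem_gDom_one _ u v z).1 hz).1
    have h := (rowsB_snoc_iff.1 h0).2
    rw [affB_neg', hhz] at h
    linarith

/-- **The residual hypothesis `Hpar` from its TRIPLE cells** (any base dimension `B + 1`). The
data of `Hpar` over a bounded base cell is congruent modulo `KZ.relations` to the subgroup
generated by `GG B 2 1` as soon as this holds for its restrictions to the product cells
`{x'-rows M₀} × (ylo(x'), yhi(x'))` whose closed cell contains a triple point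
`ylo = yhi`, `u = v`, `u₀ + s ℓ₂ = 0` (`Htriple`): `par_cells` + `good_parCell_of_noTriple'`. -/
theorem good_par_of_triple (s : KZ.IntegralRep (B + 1 + 1)) (M : Fin m' → (Fin (B + 1) → ℚ) × ℚ)
    (p : MvPolynomial (Fin B) ℚ) (u v : (Fin (B + 1) → ℚ) × ℚ) (hbd : Bornology.IsBounded s.domain)
    (hdom : s.domain = gDom B 1 m' M (fun _ => Sum.inr u) (fun _ => Sum.inr v))
    (hint : EqOn s.integrand (glit B 1 p L e ℓ₁ ℓ₂ 0 1 (fun _ => some 0)) s.domain)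
    (hu : u.1 (Fin.last B) ≠ 0) (hpar : u.1 (Fin.last B) = v.1 (Fin.last B))
    (hcell : ∀ z : Fin (B + 1 + 1) → ℝ, (∀ j, 0 < affF B 1 (M j) z) →
      0 < affF B 1 u z ∧ affF B 1 u z < affF B 1 v z)
    (Htriple : ∀ (m'' m₀ : ℕ) (s' : KZ.IntegralRep (B + 1 + 1)) (M' : Fin m'' → (Fin (B + 1) → ℚ) × ℚ)
      (M₀ : Fin m₀ → (Fin B → ℚ) × ℚ) (ylo yhi : (Fin B → ℚ) × ℚ), Bornology.IsBounded s'.domain →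
      s'.domain = gDom B 1 m'' M' (fun _ => Sum.inr u) (fun _ => Sum.inr v) →
      EqOn s'.integrand (glit B 1 p L e ℓ₁ ℓ₂ 0 1 (fun _ => some 0)) s'.domain →
      (∀ z : Fin (B + 1 + 1) → ℝ, (∀ j, 0 < affF B 1 (M' j) z) →
        0 < affF B 1 u z ∧ affF B 1 u z < affF B 1 v z) →
      (∀ z : Fin (B + 1 + 1) → ℝ, (∀ j, 0 < affF B 1 (M' j) z) ↔ ((∀ j, 0 < affB B 1 (M₀ j) z) ∧
        affB B 1 ylo z < z (Fin.castAdd 1 (Fin.last B)) ∧ z (Fin.castAdd 1 (Fin.last B)) < affB B 1 yhi z)) →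
      (∃ z ∈ closure {z : Fin (B + 1 + 1) → ℝ | ∀ j, 0 < affF B 1 (M' j) z},
        affB B 1 ylo z = affB B 1 yhi z ∧ affF B 1 u z = affF B 1 v z ∧
          affB B 1 (restr B u) z + (u.1 (Fin.last B) : ℝ) * affB B 1 ℓ₂ z = 0) →
      ∃ c ∈ AddSubgroup.closure (GGset B 2 1), KZ.of s' - c ∈ KZ.relations) :
    ∃ c ∈ AddSubgroup.closure (GGset B 2 1), KZ.of s - c ∈ KZ.relations :=
  par_cells s M u v hbd hdom fun m'' m₀ s' M' M₀ ylo yhi hsub hi' hd' hsec hbase => by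
    by_cases htr : ∃ z ∈ closure {z : Fin (B + 1 + 1) → ℝ | ∀ j, 0 < affF B 1 (M' j) z},
        affB B 1 ylo z = affB B 1 yhi z ∧ affF B 1 u z = affF B 1 v z ∧
          affB B 1 (restr B u) z + (u.1 (Fin.last B) : ℝ) * affB B 1 ℓ₂ z = 0
    · exact Htriple m'' m₀ s' M' M₀ ylo yhi (hbd.subset hsub) hd' (by rw [hi']; exact hint.mono hsub)
        (fun z hz => hcell z (hbase z hz)) hsec htr
    · push Not at htr
      exact good_parCell_of_noTriple' L e ℓ₁ ℓ₂ s' M' M₀ ylo yhi p u v (hbd.subset hsub) hd'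
        (by rw [hi']; exact hint.mono hsub) hu hpar (fun z hz => hcell z (hbase z hz)) hsec
        fun z hz h1 h2 h3 => htr z hz h1 h2 h3

end TripleFlat

end RebasePos

/-- **Registered part of `stub_rebaseSimplePosOnePos` (line `janus-bands`): the residual
hypothesis `Hpar` of the one-fibre rebase from its TRIPLE cells, any base dimension.** The data
of `Hpar` (one lettered fibre over a bounded base cell in `ℝ^{B+1}`, letter `0`, affine bounds
`0 < u < v` parallel in `y` with common slope `s = u_y ≠ 0`, base factor
`p(x')/∏ Lⱼ(x')^{eⱼ} · 1/(y − ℓ₂(x'))`): `[s] ∈ closure (GG B 2 1)` modulo `KZ.relations` AS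
SOON AS this holds for the restrictions to the product cells `{x'-rows M₀} × (ylo(x'), yhi(x'))`
(`hsec`) whose closed cell contains a TRIPLE point: `ylo = yhi`, `u = v` and `u₀ + s ℓ₂ = 0`
(`Htriple`). Everything else: `rebaseSimplePos_par_cells`, `rebaseSimplePos_par_noTriple`
(extreme value theorem for `max (h, w, |κ'|)`, cuts at `h = δ`, `w = |s| h`, `κ' = 0`;
`par_nonpinch`, `par_level`, dominated partial fractions `par_dominated`). -/
theorem rebaseSimplePos_par_of_triple (B m m' : ℕ) (s : KZ.IntegralRep (B + 1 + 1)) (M : Fin m' → (Fin (B + 1) → ℚ) × ℚ) (L : Fin m → (Fin B → ℚ) × ℚ) (e : Fin m → ℕ) (p : MvPolynomial (Fin B) ℚ) (ℓ₁ ℓ₂ : (Fin B → ℚ) × ℚ) (u v : (Fin (B + 1) → ℚ) × ℚ) (hbd : Bornology.IsBounded s.domain) (hdom : s.domain = SeparatePos.gDom B 1 m' M (fun _ => Sum.inr u) (fun _ => Sum.inr v)) (hint : Set.EqOn s.integrand (RebasePos.glit B 1 p L e ℓ₁ ℓ₂ 0 1 (fun _ => some 0)) s.domain) (hu : u.1 (Fin.last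 B) ≠ 0) (hpar : u.1 (Fin.last B) = v.1 (Fin.last B)) (hcell : ∀ z : Fin (B + 1 + 1) → ℝ, (∀ j, 0 < SeparatePos.affF B 1 (M j) z) → 0 < SeparatePos.affF B 1 u z ∧ SeparatePos.affF B 1 u z < SeparatePos.affF B 1 v z) (Htriple : ∀ (m'' m₀ : ℕ) (s' : KZ.IntegralRep (B + 1 + 1)) (M' : Fin m'' → (Fin (B + 1) → ℚ) × ℚ) (M₀ : Fin m₀ → (Fin B → ℚ) × ℚ) (ylo yhi : (Fin B → ℚ) × ℚ), Bornology.IsBounded s'.domain → s'.domain = SeparatePos.gDom B 1 m'' M' (fun _ => Sum.inr u) (fun _ => Sum.inr v) → EqOn s'.integrand (RebasePos.glit B 1 p L e ℓ₁ ℓ₂ 0 1 (fun _ => some 0)) s'.domain → (∀ z : Fin (B + 1 + 1) → ℝ, (∀ j, 0 < SeparatePos.affF B 1 (M' j) z) → 0 < SeparatePos.affF B 1 u z ∧ SeparatePos.affF B 1 u z < SeparatePos.affF B 1 v z) → (∀ z : Fin (B + 1 + 1) → ℝ, (∀ j, 0 < SeparatePos.affF B 1 (M' j) z) ↔ ((∀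 j, 0 < SeparatePos.affB B 1 (M₀ j) z) ∧ SeparatePos.affB B 1 ylo z < z (Fin.castAdd 1 (Fin.last B)) ∧ z (Fin.castAdd 1 (Fin.last B)) < SeparatePos.affB B 1 yhi z)) → (∃ z ∈ closure {z : Fin (B + 1 + 1) → ℝ | ∀ j, 0 < SeparatePos.affF B 1 (M' j) z}, SeparatePos.affB B 1 ylo z = SeparatePos.affB B 1 yhi z ∧ SeparatePos.affF B 1 u z = SeparatePos.affF B 1 v z ∧ SeparatePos.affB B 1 (SeparatePos.restr B u) z + (u.1 (Fin.last B) : ℝ) * SeparatePos.affB B 1 ℓ₂ z = 0) → ∃ c ∈ AddSubgroup.closure (SeparatePos.GGset B 2 1), KZ.of s' - c ∈ KZ.relations) : ∃ c ∈ AddSubgroup.closure (SeparatePos.GGset B 2 1), KZ.of s - c ∈ KZ.relations :=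
  RebasePos.good_par_of_triple L e ℓ₁ ℓ₂ s M p u v hbd hdom hint hu hpar hcell Htriple

/-- **The stub `stub_rebaseSimplePosOnePos` reduced to triple points and double corners**
(exactly its signature plus `HparTriple`, `Hdthick`, `Hdfar` at `B = b + 2`):
`GS (b+2) 1 → closure (GG (b+2) 2 1 ∪ JJ (b+2) 2 ∪ JD (b+3))` modulo `KZ.relations`.
`HparTriple`: parallel transverse bands over a product cell `{x'-rows M₀} × (ylo(x'), yhi(x'))`
whose closed cell contains a triple point `ylo = yhi`, `u = v`, `u₀ + s ℓ₂ = 0`; `Hdthick` /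
`Hdfar`: verbatim from `rebaseSimplePosOnePos_of_flats'` (part `Flats`), which is fed with
`RebasePos.good_parCell_of_noTriple'` on the flat cells without triple point. -/
theorem rebaseSimplePosOnePos_of_triple' (GS : ℕ → ℕ → Set KZ.FormalRep) (GG : ℕ → ℕ → ℕ → Set KZ.FormalRep) (hGS : ∀ b k, GS b k = {w : KZ.FormalRep | ∃ (m m' n₁ n₂ : ℕ) (s : KZ.IntegralRep (b + 1 + k)) (M : Fin m' → (Fin (b + 1) → ℚ) × ℚ) (L : Fin m → (Fin b → ℚ) × ℚ) (e : Fin m → ℕ) (p : MvPolynomial (Fin b) ℚ) (ℓ₁ ℓ₂ : (Fin b → ℚ) × ℚ) (a : Fin k → Option ((Fin (b + 1) → ℚ) × ℚ)) (lo hi : Fin k → Fin k ⊕ ((Fin (b + 1) → ℚ) × ℚ)), (n₁ = 0 ∨ n₂ = 0) ∧ n₂ = 1 ∧ Bornology.IsBounded s.domain ∧ s.domain = {z | (∀ j, 0 < ∑ i, ((M j).1 i : ℝ) * z (Fin.castAdd k i) + ((M j).2 : ℝ)) ∧ ∀ i, Sum.elim (fun j => z (Fin.natAdd (b + 1) j))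 (fun c => ∑ i', (c.1 i' : ℝ) * z (Fin.castAdd k i') + (c.2 : ℝ)) (lo i) < z (Fin.natAdd (b + 1) i) ∧ z (Fin.natAdd (b + 1) i) < Sum.elim (fun j => z (Fin.natAdd (b + 1) j)) (fun c => ∑ i', (c.1 i' : ℝ) * z (Fin.castAdd k i') + (c.2 : ℝ)) (hi i)} ∧ EqOn s.integrand (fun z => MvPolynomial.aeval (fun i => z (Fin.castAdd k (Fin.castSucc i))) p / (∏ j, (∑ i, ((L j).1 i : ℝ) * z (Fin.castAdd k (Fin.castSucc i)) + ((L j).2 : ℝ)) ^ e j) * ((z (Fin.castAdd k (Fin.last b)) - (∑ i, (ℓ₁.1 i : ℝ) * z (Fin.castAdd k (Fin.castSucc i)) + (ℓ₁.2 : ℝ))) ^ n₁ / (z (Fin.castAdd k (Fin.last b)) - (∑ i, (ℓ₂.1 i : ℝ) * z (Fin.castAdd k (Fin.castSucc i)) + (ℓ₂.2 : ℝ))) ^ n₂) * ∏ i, (a i).elim 1 (fun c => 1 / (z (Fin.natAdd (b + 1) i) - (∑ i', (c.1 i' : ℝ) * z (Fin.castAdd k i') + (c.2 : ℝ))))) s.domain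 ∧ w = KZ.of s}) (hGG : ∀ b σ k, GG b σ k = {w : KZ.FormalRep | ∃ (m m' n₁ n₂ : ℕ) (s : KZ.IntegralRep (b + 1 + k)) (M : Fin m' → (Fin (b + 1) → ℚ) × ℚ) (L : Fin m → (Fin b → ℚ) × ℚ) (e : Fin m → ℕ) (p : MvPolynomial (Fin b) ℚ) (ℓ₁ ℓ₂ : (Fin b → ℚ) × ℚ) (a : Fin k → Option ((Fin (b + 1) → ℚ) × ℚ)) (lo hi : Fin k → Fin k ⊕ ((Fin (b + 1) → ℚ) × ℚ)), (n₁ = 0 ∨ n₂ = 0) ∧ (σ = 2 → (∀ i c, a i = some c → c.1 (Fin.last b) = 0) ∧ (∀ i c, (lo i = Sum.inr c ∨ hi i = Sum.inr c) → (c.1 (Fin.last b) = 0 ∨ c = (Pi.single (Fin.last b) 1, 0)))) ∧ Bornology.IsBounded s.domain ∧ s.domain = {z | (∀ j, 0 < ∑ i, ((M j).1 i : ℝ) * z (Fin.castAdd k i) + ((M j).2 : ℝ)) ∧ ∀ i, Sum.elim (fun j => z (Fin.natAdd (b + 1) j)) (fun c => ∑ i', (c.1 i' : ℝ) * z (Fin.castAdd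 k i') + (c.2 : ℝ)) (lo i) < z (Fin.natAdd (b + 1) i) ∧ z (Fin.natAdd (b + 1) i) < Sum.elim (fun j => z (Fin.natAdd (b + 1) j)) (fun c => ∑ i', (c.1 i' : ℝ) * z (Fin.castAdd k i') + (c.2 : ℝ)) (hi i)} ∧ EqOn s.integrand (fun z => MvPolynomial.aeval (fun i => z (Fin.castAdd k (Fin.castSucc i))) p / (∏ j, (∑ i, ((L j).1 i : ℝ) * z (Fin.castAdd k (Fin.castSucc i)) + ((L j).2 : ℝ)) ^ e j) * ((z (Fin.castAdd k (Fin.last b)) - (∑ i, (ℓ₁.1 i : ℝ) * z (Fin.castAdd k (Fin.castSucc i)) + (ℓ₁.2 : ℝ))) ^ n₁ / (z (Fin.castAdd k (Fin.last b)) - (∑ i, (ℓ₂.1 i : ℝ) * z (Fin.castAdd k (Fin.castSucc i)) + (ℓ₂.2 : ℝ))) ^ n₂) * ∏ i, (a i).elim 1 (fun c => 1 / (z (Fin.natAdd (b + 1) i) - (∑ i', (c.1 i' : ℝ) * z (Fin.castAdd k i') + (c.2 : ℝ))))) s.domain ∧ w = KZ.of s}) (JJ : ℕ → ℕ → Set KZ.FormalRep)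 (JD : ℕ → Set KZ.FormalRep) (hJJ : ∀ b k, JJ b k = {w : KZ.FormalRep | ∃ (m m' : ℕ) (s : KZ.IntegralRep (b + k)) (M : Fin m' → (Fin b → ℚ) × ℚ) (L : Fin m → (Fin b → ℚ) × ℚ) (e : Fin m → ℕ) (p : MvPolynomial (Fin b) ℚ) (a : Fin k → Option ((Fin b → ℚ) × ℚ)) (lo hi : Fin k → Fin k ⊕ ((Fin b → ℚ) × ℚ)), Bornology.IsBounded s.domain ∧ s.domain = {z | (∀ j, 0 < ∑ i, ((M j).1 i : ℝ) * z (Fin.castAdd k i) + ((M j).2 : ℝ)) ∧ ∀ i, Sum.elim (fun j => z (Fin.natAdd b j)) (fun c => ∑ i', (c.1 i' : ℝ) * z (Fin.castAdd k i') + (c.2 : ℝ)) (lo i) < z (Fin.natAdd b i) ∧ z (Fin.natAdd b i) < Sum.elim (fun j => z (Fin.natAdd b j)) (fun c => ∑ i', (c.1 i' : ℝ) * z (Fin.castAdd k i') + (c.2 : ℝ)) (hi i)} ∧ EqOn s.integrand (fun z => MvPolynomial.aeval (fun i => z (Fin.castAdd k i)) p / (∏ j, (∑ i, ((L j).1 i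 : ℝ) * z (Fin.castAdd k i) + ((L j).2 : ℝ)) ^ e j) * ∏ i, (a i).elim 1 (fun c => 1 / (z (Fin.natAdd b i) - (∑ i', (c.1 i' : ℝ) * z (Fin.castAdd k i') + (c.2 : ℝ))))) s.domain ∧ w = KZ.of s}) (hJD : ∀ N, JD N = {w : KZ.FormalRep | ∃ b' k', b' + k' = N ∧ w ∈ JJ b' k'}) (b : ℕ) (HparTriple : ∀ (m : ℕ) (L : Fin m → (Fin (b + 1 + 1) → ℚ) × ℚ) (e : Fin m → ℕ) (ℓ₁ ℓ₂ : (Fin (b + 1 + 1) → ℚ) × ℚ) (m' m₀ : ℕ) (s : KZ.IntegralRep (b + 1 + 1 + 1 + 1)) (M : Fin m' → (Fin (b + 1 + 1 + 1) → ℚ) × ℚ) (M₀ : Fin m₀ → (Fin (b + 1 + 1) → ℚ) × ℚ) (ylo yhi : (Fin (b + 1 + 1) → ℚ) × ℚ) (p : MvPolynomial (Fin (b + 1 + 1)) ℚ) (u v : (Fin (b + 1 + 1 + 1) → ℚ) × ℚ), Bornology.IsBounded s.domain → s.domain = SeparatePos.gDom (b + 1 + 1) 1 m' M (fun _ => Sum.inr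 u) (fun _ => Sum.inr v) → EqOn s.integrand (RebasePos.glit (b + 1 + 1) 1 p L e ℓ₁ ℓ₂ 0 1 (fun _ => some 0)) s.domain → u.1 (Fin.last (b + 1 + 1)) ≠ 0 → u.1 (Fin.last (b + 1 + 1)) = v.1 (Fin.last (b + 1 + 1)) → (∀ z : Fin (b + 1 + 1 + 1 + 1) → ℝ, (∀ j, 0 < SeparatePos.affF (b + 1 + 1) 1 (M j) z) → 0 < SeparatePos.affF (b + 1 + 1) 1 u z ∧ SeparatePos.affF (b + 1 + 1) 1 u z < SeparatePos.affF (b + 1 + 1) 1 v z) → (∀ z : Fin (b + 1 + 1 + 1 + 1) → ℝ, (∀ j, 0 < SeparatePos.affF (b + 1 + 1) 1 (M j) z) ↔ ((∀ j, 0 < SeparatePos.affB (b + 1 + 1) 1 (M₀ j) z) ∧ SeparatePos.affB (b + 1 + 1) 1 ylo z < z (Fin.castAdd 1 (Fin.last (b + 1 + 1))) ∧ z (Fin.castAdd 1 (Fin.last (b + 1 + 1))) < SeparatePos.affB (b + 1 + 1) 1 yhi z)) → (∃ z ∈ closure {z : Fin (b + 1 + 1 + 1 + 1) → ℝ | ∀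 j, 0 < SeparatePos.affF (b + 1 + 1) 1 (M j) z}, SeparatePos.affB (b + 1 + 1) 1 ylo z = SeparatePos.affB (b + 1 + 1) 1 yhi z ∧ SeparatePos.affF (b + 1 + 1) 1 u z = SeparatePos.affF (b + 1 + 1) 1 v z ∧ SeparatePos.affB (b + 1 + 1) 1 (SeparatePos.restr (b + 1 + 1) u) z + (u.1 (Fin.last (b + 1 + 1)) : ℝ) * SeparatePos.affB (b + 1 + 1) 1 ℓ₂ z = 0) → ∃ c ∈ AddSubgroup.closure (SeparatePos.GGset (b + 1 + 1) 2 1), KZ.of s - c ∈ KZ.relations) (Hdthick : ∀ (m : ℕ) (L : Fin m → (Fin (b + 1 + 1) → ℚ) × ℚ) (e : Fin m → ℕ) (ℓ₁ ℓ₂ : (Fin (b + 1 + 1) → ℚ) × ℚ), ∀ (m' : ℕ) (s : KZ.IntegralRep (b + 1 + 1 + 1 + 1)) (M : Fin m' → (Fin (b + 1 + 1 + 1) → ℚ) × ℚ) (p : MvPolynomial (Fin (b + 1 + 1)) ℚ) (u v κ : (Fin (b + 1 + 1 + 1) → ℚ) × ℚ) (A : ℚ), Bornology.IsBounded s.domain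 → s.domain = SeparatePos.gDom (b + 1 + 1) 1 m' M (fun _ => Sum.inr u) (fun _ => Sum.inr v) → EqOn s.integrand (RebasePos.glit (b + 1 + 1) 1 p L e ℓ₁ ℓ₂ 0 1 (fun _ => some 0)) s.domain → κ.1 (Fin.last (b + 1 + 1)) = 0 → u - κ = A • (v - u) → 0 < A → (∀ z : Fin (b + 1 + 1 + 1 + 1) → ℝ, (∀ j, 0 < SeparatePos.affF (b + 1 + 1) 1 (M j) z) → SeparatePos.affF (b + 1 + 1) 1 κ z < 0 ∧ 0 < SeparatePos.affF (b + 1 + 1) 1 u z ∧ SeparatePos.affF (b + 1 + 1) 1 u z < SeparatePos.affF (b + 1 + 1) 1 v z) → (∃ z ∈ closure {z : Fin (b + 1 + 1 + 1 + 1) → ℝ | ∀ j, 0 < SeparatePos.affF (b + 1 + 1) 1 (M j) z}, SeparatePos.affF (b + 1 + 1) 1 κ z = 0 ∧ SeparatePos.affF (b + 1 + 1) 1 u z = 0 ∧ SeparatePos.affF (b + 1 + 1) 1 v z = 0 ∧ z (Fin.castAdd 1 (Fin.last (b + 1 + 1))) = SeparatePos.affB (b + 1 + 1) 1 ℓ₂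 z) → ∃ c ∈ AddSubgroup.closure (SeparatePos.GGset (b + 1 + 1) 2 1), KZ.of s - c ∈ KZ.relations) (Hdfar : ∀ (m : ℕ) (L : Fin m → (Fin (b + 1 + 1) → ℚ) × ℚ) (e : Fin m → ℕ) (ℓ₁ ℓ₂ : (Fin (b + 1 + 1) → ℚ) × ℚ), ∀ (m' : ℕ) (s : KZ.IntegralRep (b + 1 + 1 + 1 + 1)) (M : Fin m' → (Fin (b + 1 + 1 + 1) → ℚ) × ℚ) (p : MvPolynomial (Fin (b + 1 + 1)) ℚ) (u v κ : (Fin (b + 1 + 1 + 1) → ℚ) × ℚ) (A : ℚ), Bornology.IsBounded s.domain → s.domain = SeparatePos.gDom (b + 1 + 1) 1 m' M (fun _ => Sum.inr u) (fun _ => Sum.inr v) → EqOn s.integrand (RebasePos.glit (b + 1 + 1) 1 p L e ℓ₁ ℓ₂ 0 1 (fun _ => some 0)) s.domain → κ.1 (Fin.last (b + 1 + 1)) = 0 → u - κ = A • (v - u) → 0 < A → (∀ z : Fin (b + 1 + 1 + 1 + 1) → ℝ, (∀ j, 0 < SeparatePos.affF (b + 1 + 1) 1 (M j) z) → 0 <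 SeparatePos.affF (b + 1 + 1) 1 κ z ∧ SeparatePos.affF (b + 1 + 1) 1 u z < SeparatePos.affF (b + 1 + 1) 1 v z ∧ 2 * SeparatePos.affF (b + 1 + 1) 1 κ z ≤ SeparatePos.affF (b + 1 + 1) 1 v z) → (∃ z ∈ closure {z : Fin (b + 1 + 1 + 1 + 1) → ℝ | ∀ j, 0 < SeparatePos.affF (b + 1 + 1) 1 (M j) z}, SeparatePos.affF (b + 1 + 1) 1 κ z = 0 ∧ SeparatePos.affF (b + 1 + 1) 1 u z = 0 ∧ SeparatePos.affF (b + 1 + 1) 1 v z = 0 ∧ z (Fin.castAdd 1 (Fin.last (b + 1 + 1))) = SeparatePos.affB (b + 1 + 1) 1 ℓ₂ z) → ∃ c ∈ AddSubgroup.closure (SeparatePos.GGset (b + 1 + 1) 2 1), KZ.of s - c ∈ KZ.relations) : ∀ x ∈ GS (b + 2) 1, ∃ c ∈ AddSubgroup.closure (GG (b + 2) 2 1 ∪ JJ (b + 2) 2 ∪ JD (b + 3)), x - c ∈ KZ.relations :=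
  rebaseSimplePosOnePos_of_flats' GS GG hGS hGG JJ JD hJJ hJD b
    (fun m L e ℓ₁ ℓ₂ m' m₀ s M M₀ ylo yhi p u v hbd hdom hint hu hpar hcell hsec _ => by
      by_cases htr : ∃ z ∈ closure {z : Fin (b + 1 + 1 + 1 + 1) → ℝ | ∀ j, 0 < SeparatePos.affF (b + 1 + 1) 1 (M j) z},
          SeparatePos.affB (b + 1 + 1) 1 ylo z = SeparatePos.affB (b + 1 + 1) 1 yhi z ∧
            SeparatePos.affF (b + 1 + 1) 1 u z = SeparatePos.affF (b + 1 + 1) 1 v z ∧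
            SeparatePos.affB (b + 1 + 1) 1 (SeparatePos.restr (b + 1 + 1) u) z +
              (u.1 (Fin.last (b + 1 + 1)) : ℝ) * SeparatePos.affB (b + 1 + 1) 1 ℓ₂ z = 0
      · exact HparTriple m L e ℓ₁ ℓ₂ m' m₀ s M M₀ ylo yhi p u v hbd hdom hint hu hpar hcell hsec htr
      · push Not at htr
        exact RebasePos.good_parCell_of_noTriple' L e ℓ₁ ℓ₂ s M M₀ ylo yhi p u v hbd hdom hint hu hpar hcell hsec
          fun z hz h1 h2 h3 => htr z hz h1 h2 h3)
    Hdthick Hdfar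

end Summit.KontsevichZagierPeriods.ArrangementNormalForm.JanusBands
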